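import Summits.CriticalPhenomena.PercolationContinuityZ3.Theorems.PercAnnulusCrossingIICShellVolumesMixedMoments
import Summits.CriticalPhenomena.PercolationContinuityZ3.Theorems.PercAnnulusCrossingIICMeasureVertex
import HarnessLib

/-!
# Typical scales of Kesten's IIC, I: the density of fat shells — an exponential-moment counting lemma and the mixed moments (lane RSW3, p1 gen 20)

builds on p205010 (kernel theorem, internal audit signed; external expert review pending) — NOT used in this file
(only `p_c(ℤ^d) > 0`).

RSW3 lane (LANE 3 `prim-rsw3`), seat `prim-rsw3-p1` (gen 20).  Helper file (`--supports stmt-CriticalPhenomena-4575`);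
no definitions, no sorries.  Memo `run/shared/lean/prim/rsw3/P1-QM.md` §33.

Gen 19 (14) proved that ALL mixed moments of the shell volumes `V_R = |C(0) ∩ (Λ(2R) ∖ Λ(R))|` of the IIC at separated scales
factorise, `E_ν[∏_{i∈I} V_{R_i}] ≤ A·K^{#I}·∏_{i∈I} E_ν[V_{R_i}]`.  A strong law `(1/k)Σ_{i<k} V_{R_i}/E V_{R_i} → 1` is NOT available
(the factorisation constant is `K`, not `1 + o(1)`), but the factorisation of ALL mixed moments is exactly what an exponential-moment
(Chernoff) count needs.  By Markov, `ν(⋂_{i∈I}{V_{R_i} ≥ M·E V_{R_i}}) ≤ A (K/M)^{#I}` for every finite set of scales `I`; and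

* **`pow_mul_measureReal_le_card_filter_le`** — COUNTING LEMMA (any finite measure, events `F_i`): if `ν(⋂_{i∈I} F_i) ≤ A q^{#I}` for all
  finite `I ⊆ ℕ`, then **`(1+t)^m · ν(#{i<k : F_i} ≥ m) ≤ A (1+tq)^k`** (`t ≥ 0`): expand `(1+t)^{N_k} = Σ_{I ⊆ good} t^{#I}` and integrate;
* **`ae_eventually_card_filter_le_mul`** — hence, if `2q ≤ ε` (`ε > 0`): **`ν`-a.s., for all large `k`, `#{i < k : F_i} ≤ ε k`** (`t = 1`,
  `(1+q)/2^ε < 1` since `2^ε ≥ 1 + ε log 2 > 1 + ε/2`, Borel–Cantelli);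
* `measureReal_biInter_le_of_integral_prod_le` — Markov for products: `∏_i (M m_i) · ν(⋂_i {M m_i ≤ X_i}) ≤ ∫ ∏_i X_i` (`X_i ≥ 0`);
* **`exists_iicMeasure_ae_density_fatShells_le_criticalProbI`** — at `p_c(ℤ^d)`, `d ≥ 2`, under (A2)□(s,L) + `CU⁺_l` + UAD: there are
  `ρ', R₀ ≥ 1` and `K > 0` such that for every IIC probability measure `ν`, every `ε > 0` and every `M ≥ 2K/ε`, with `R_i = R₀ ρ'^i`:
  **`ν`-a.s., for all large `k`, `#{i < k : V_{R_i} ≥ M · E_ν V_{R_i}} ≤ ε k`** — AT ALL BUT A FRACTION `ε` OF THE SCALES THE SHELL VOLUME OF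
  THE IIC IS LESS THAN `(2K/ε)` TIMES ITS MEAN; equivalently the upper density of `M`-fat scales is at most `2K/M`, almost surely.
  This is the almost-sure content of the mixed-moment factorisation (P1-QM §32.5 (f), corrected: density bounds instead of an SLLN).
References: H. Kesten, Probab. Theory Relat. Fields 73 (1986) Thm. (8); standard Chernoff counting.
-/

noncomputable section

namespace Summit.CriticalPhenomena.PercolationContinuityZ3.Theorems.Crossing

open MeasureTheory Filter Topology Literature.Probability.Percolation Literature.Probability.LatticeModels
open Literature.Probability.Percolation.DCT16
open Summit.CriticalPhenomena.PercolationContinuityZ3.Theorems.SurfaceTension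

variable {d : ℕ}

/-! ## §1 The counting lemma -/

section Counting

variable {Ω : Type*} [MeasurableSpace Ω]

open Classical in
/-- The level set `{#{i < k : ω ∈ F_i} ≥ m}` is a finite union of finite intersections of the `F_i`, hence measurable. [folklore] -/
theorem measurableSet_setOf_le_card_filter (F : ℕ → Set Ω) (hF : ∀ i, MeasurableSet (F i)) (k m : ℕ) :
    MeasurableSet {ω : Ω | m ≤ ((Finset.range k).filter fun i => ω ∈ F i).card} := by
  have h : {ω : Ω | m ≤ ((Finset.range k).filter fun i => ω ∈ F i).card} =
      ⋃ I ∈ (Finset.range k).powerset.filter (fun I => m ≤ I.card), ⋂ i ∈ I, F i := by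
    ext ω
    simp only [Set.mem_setOf_eq, Set.mem_iUnion, Set.mem_iInter, Finset.mem_filter, Finset.mem_powerset, exists_prop]
    constructor
    · intro hm
      exact ⟨(Finset.range k).filter fun i => ω ∈ F i, ⟨Finset.filter_subset _ _, hm⟩, fun i hi => (Finset.mem_filter.1 hi).2⟩
    · rintro ⟨I, ⟨hIk, hIm⟩, hI⟩
      refine hIm.trans (Finset.card_le_card fun i hi => Finset.mem_filter.2 ⟨hIk hi, hI i hi⟩)
  rw [h]
  exact Finset.measurableSet_biUnion _ fun I _ => Finset.measurableSet_biInter _ fun i _ => hF i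

omit [MeasurableSpace Ω] in
open Classical in
/-- Pointwise expansion: `Σ_{I ⊆ {0..k-1}} t^{#I} · 1[ω ∈ ⋂_{i∈I} F_i] = (1+t)^{#{i<k : ω ∈ F_i}}`. [folklore] -/
theorem sum_pow_mul_indicator_biInter_eq (F : ℕ → Set Ω) (t : ℝ) (k : ℕ) (ω : Ω) :
    ∑ I ∈ (Finset.range k).powerset, t ^ I.card * (⋂ i ∈ I, F i).indicator (1 : Ω → ℝ) ω =
      (1 + t) ^ ((Finset.range k).filter fun i => ω ∈ F i).card := by
  set G := (Finset.range k).filter fun i => ω ∈ F i with hG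
  have hGk : G ⊆ Finset.range k := Finset.filter_subset _ _
  have hind : ∀ I ∈ (Finset.range k).powerset, (⋂ i ∈ I, F i).indicator (1 : Ω → ℝ) ω = if I ⊆ G then 1 else 0 := by
    intro I hI
    have hIk := Finset.mem_powerset.1 hI
    by_cases h : I ⊆ G
    · rw [if_pos h, Set.indicator_of_mem, Pi.one_apply]
      exact Set.mem_iInter₂.2 fun i hi => (Finset.mem_filter.1 (h hi)).2
    · rw [if_neg h, Set.indicator_of_notMem]
      intro hω
      exact h fun i hi => Finset.mem_filter.2 ⟨hIk hi, Set.mem_iInter₂.1 hω i hi⟩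
  calc ∑ I ∈ (Finset.range k).powerset, t ^ I.card * (⋂ i ∈ I, F i).indicator (1 : Ω → ℝ) ω
      = ∑ I ∈ (Finset.range k).powerset, (if I ⊆ G then t ^ I.card else 0) := by
        refine Finset.sum_congr rfl fun I hI => ?_
        rw [hind I hI]
        split_ifs <;> simp
    _ = ∑ I ∈ (Finset.range k).powerset.filter (fun I => I ⊆ G), t ^ I.card := by rw [Finset.sum_filter]
    _ = ∑ I ∈ G.powerset, t ^ I.card * 1 ^ (G.card - I.card) := by
        have hset : (Finset.range k).powerset.filter (fun I => I ⊆ G) = G.powerset := by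
          ext I
          simp only [Finset.mem_filter, Finset.mem_powerset]
          exact ⟨fun h => h.2, fun h => ⟨h.trans hGk, h⟩⟩
        rw [hset]
        exact Finset.sum_congr rfl fun I _ => by rw [one_pow, mul_one]
    _ = (1 + t) ^ G.card := by rw [Finset.sum_pow_mul_eq_add_pow, add_comm]

open Classical in
/-- **THE COUNTING LEMMA.**  Let `ν` be a finite measure and `F_i` (`i ∈ ℕ`) measurable events with
`ν(⋂_{i∈I} F_i) ≤ A · q^{#I}` for every finite `I ⊆ ℕ` (`A, q, t ≥ 0`).  Then for all `k, m`:
**`(1+t)^m · ν(#{i < k : F_i} ≥ m) ≤ A · (1 + tq)^k`** (integrate `(1+t)^m 1[N_k ≥ m] ≤ (1+t)^{N_k} = Σ_{I ⊆ good} t^{#I}`).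
[cite: Kesten1986, Thm. (8)] -/
theorem pow_mul_measureReal_le_card_filter_le (ν : Measure Ω) [IsFiniteMeasure ν] (F : ℕ → Set Ω)
    (hF : ∀ i, MeasurableSet (F i)) {A q t : ℝ} (ht : 0 ≤ t)
    (hprod : ∀ I : Finset ℕ, ν.real (⋂ i ∈ I, F i) ≤ A * q ^ I.card) (k m : ℕ) :
    (1 + t) ^ m * ν.real {ω : Ω | m ≤ ((Finset.range k).filter fun i => ω ∈ F i).card} ≤ A * (1 + t * q) ^ k := by
  set E := {ω : Ω | m ≤ ((Finset.range k).filter fun i => ω ∈ F i).card} with hE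
  have hEm : MeasurableSet E := measurableSet_setOf_le_card_filter F hF k m
  have hind : ∀ S : Set Ω, MeasurableSet S → Integrable (S.indicator (1 : Ω → ℝ)) ν :=
    fun S hS => (integrable_const (1 : ℝ)).indicator hS
  have hmeasI : ∀ I : Finset ℕ, MeasurableSet (⋂ i ∈ I, F i) := fun I => Finset.measurableSet_biInter I fun i _ => hF i
  -- pointwise inequality
  have hpt : ∀ ω, (1 + t) ^ m * E.indicator (1 : Ω → ℝ) ω ≤
      ∑ I ∈ (Finset.range k).powerset, t ^ I.card * (⋂ i ∈ I, F i).indicator (1 : Ω → ℝ) ω := by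
    intro ω
    rw [sum_pow_mul_indicator_biInter_eq]
    by_cases hω : ω ∈ E
    · rw [Set.indicator_of_mem hω, Pi.one_apply, mul_one]
      exact pow_le_pow_right₀ (by linarith) hω
    · rw [Set.indicator_of_notMem hω, mul_zero]
      positivity
  -- integrate
  have hL : ∫ ω, (1 + t) ^ m * E.indicator (1 : Ω → ℝ) ω ∂ν = (1 + t) ^ m * ν.real E := by
    rw [integral_const_mul, integral_indicator_one hEm]
  have hR : ∫ ω, ∑ I ∈ (Finset.range k).powerset, t ^ I.card * (⋂ i ∈ I, F i).indicator (1 : Ω → ℝ) ω ∂ν =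
      ∑ I ∈ (Finset.range k).powerset, t ^ I.card * ν.real (⋂ i ∈ I, F i) := by
    rw [integral_finsetSum _ fun I _ => (hind _ (hmeasI I)).const_mul _]
    exact Finset.sum_congr rfl fun I _ => by rw [integral_const_mul, integral_indicator_one (hmeasI I)]
  have hmono : ∫ ω, (1 + t) ^ m * E.indicator (1 : Ω → ℝ) ω ∂ν ≤
      ∫ ω, ∑ I ∈ (Finset.range k).powerset, t ^ I.card * (⋂ i ∈ I, F i).indicator (1 : Ω → ℝ) ω ∂ν :=
    integral_mono ((hind E hEm).const_mul _) (integrable_finsetSum _ fun I _ => (hind _ (hmeasI I)).const_mul _) hpt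
  rw [hL, hR] at hmono
  calc (1 + t) ^ m * ν.real E ≤ ∑ I ∈ (Finset.range k).powerset, t ^ I.card * ν.real (⋂ i ∈ I, F i) := hmono
    _ ≤ ∑ I ∈ (Finset.range k).powerset, t ^ I.card * (A * q ^ I.card) :=
        Finset.sum_le_sum fun I _ => mul_le_mul_of_nonneg_left (hprod I) (pow_nonneg ht _)
    _ = A * ∑ I ∈ (Finset.range k).powerset, (t * q) ^ I.card * 1 ^ ((Finset.range k).card - I.card) := by
        rw [Finset.mul_sum]
        exact Finset.sum_congr rfl fun I _ => by rw [mul_pow, one_pow, mul_one]; ring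
    _ = A * (1 + t * q) ^ k := by rw [Finset.sum_pow_mul_eq_add_pow, Finset.card_range, add_comm]

open Classical in
/-- **ALMOST SURELY THE DENSITY OF THE `F_i` IS AT MOST `ε`** (finite measure `ν`; `ν(⋂_{i∈I} F_i) ≤ A q^{#I}` for all finite `I`;
`ε > 0`, `2q ≤ ε`): **`ν`-a.s., for all large `k`, `#{i < k : F_i} ≤ ε·k`.**  Counting lemma with `t = 1` and `m = ⌊εk⌋+1`:
`ν(N_k ≥ m) ≤ A (1+q)^k 2^{−εk}`, and `(1+q)2^{−ε} < 1` because `2^ε = e^{ε log 2} ≥ 1 + ε log 2 > 1 + ε/2 ≥ 1 + q`; Borel–Cantelli.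
[cite: Kesten1986, Thm. (8)] -/
theorem ae_eventually_card_filter_le_mul (ν : Measure Ω) [IsFiniteMeasure ν] (F : ℕ → Set Ω)
    (hF : ∀ i, MeasurableSet (F i)) {A q ε : ℝ} (hA : 0 ≤ A) (hq : 0 ≤ q) (hε : 0 < ε) (hqε : 2 * q ≤ ε)
    (hprod : ∀ I : Finset ℕ, ν.real (⋂ i ∈ I, F i) ≤ A * q ^ I.card) :
    ∀ᵐ ω ∂ν, ∀ᶠ k : ℕ in atTop, ((((Finset.range k).filter fun i => ω ∈ F i).card : ℕ) : ℝ) ≤ ε * k := by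
  -- the rate `r = (1+q) 2^{-ε} < 1`
  set r : ℝ := (1 + q) * (2 : ℝ) ^ (-ε) with hr
  have h2ε : 0 < (2 : ℝ) ^ ε := Real.rpow_pos_of_pos (by norm_num) ε
  have hr0 : 0 ≤ r := mul_nonneg (by linarith) (Real.rpow_nonneg (by norm_num) _)
  have hr1 : r < 1 := by
    have hlow : 1 + ε / 2 < (2 : ℝ) ^ ε := by
      rw [Real.rpow_def_of_pos (by norm_num : (0 : ℝ) < 2)]
      have h := Real.add_one_le_exp (Real.log 2 * ε)
      have hlog : (1 : ℝ) / 2 < Real.log 2 := by linarith [Real.log_two_gt_d9]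
      nlinarith
    have hinv : (2 : ℝ) ^ (-ε) = ((2 : ℝ) ^ ε)⁻¹ := Real.rpow_neg (by norm_num) ε
    rw [hr, hinv, ← div_eq_mul_inv, div_lt_one h2ε]
    linarith
  -- the exceptional events
  set S : ℕ → Set Ω := fun k => {ω : Ω | ⌊ε * k⌋₊ + 1 ≤ ((Finset.range k).filter fun i => ω ∈ F i).card} with hS
  have hle : ∀ k, ν (S k) ≤ ENNReal.ofReal (A * r ^ k) := fun k => by
    rw [← ENNReal.ofReal_toReal (measure_ne_top ν (S k))]
    refine ENNReal.ofReal_le_ofReal ?_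
    have h1 := pow_mul_measureReal_le_card_filter_le ν F hF zero_le_one hprod k (⌊ε * k⌋₊ + 1)
    have h2 : ((2 : ℝ) ^ ε) ^ k ≤ (2 : ℝ) ^ (⌊ε * (k : ℝ)⌋₊ + 1) := by
      rw [← Real.rpow_natCast (2 : ℝ) (⌊ε * (k : ℝ)⌋₊ + 1), ← Real.rpow_mul_natCast (by norm_num : (0 : ℝ) ≤ 2)]
      refine Real.rpow_le_rpow_of_exponent_le (by norm_num) ?_
      have := Nat.lt_floor_add_one (ε * (k : ℝ))
      push_cast
      linarith
    have h2k : 0 < ((2 : ℝ) ^ ε) ^ k := pow_pos h2ε k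
    have h3 : ((2 : ℝ) ^ ε) ^ k * ν.real (S k) ≤ A * (1 + q) ^ k :=
      calc ((2 : ℝ) ^ ε) ^ k * ν.real (S k) ≤ (1 + 1 : ℝ) ^ (⌊ε * (k : ℝ)⌋₊ + 1) * ν.real (S k) := by
            rw [show (1 + 1 : ℝ) = 2 by norm_num]
            exact mul_le_mul_of_nonneg_right h2 measureReal_nonneg
        _ ≤ A * (1 + 1 * q) ^ k := h1
        _ = A * (1 + q) ^ k := by rw [one_mul]
    have hrk : r ^ k = (1 + q) ^ k / ((2 : ℝ) ^ ε) ^ k := by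
      rw [hr, mul_pow, Real.rpow_neg (by norm_num), inv_pow, div_eq_mul_inv]
    calc (ν (S k)).toReal = ν.real (S k) := rfl
      _ ≤ A * (1 + q) ^ k / ((2 : ℝ) ^ ε) ^ k := by rw [le_div_iff₀ h2k, mul_comm]; exact h3
      _ = A * r ^ k := by rw [hrk, mul_div_assoc]
  have hsum : (∑' k, ν (S k)) ≠ ⊤ := by
    have hgeom : Summable fun k : ℕ => A * r ^ k := (summable_geometric_of_lt_one hr0 hr1).mul_left A
    have hfin : (∑' k, ENNReal.ofReal (A * r ^ k)) ≠ ⊤ := by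
      rw [← ENNReal.ofReal_tsum_of_nonneg (fun k => mul_nonneg hA (pow_nonneg hr0 k)) hgeom]
      exact ENNReal.ofReal_ne_top
    exact ne_top_of_le_ne_top hfin (ENNReal.tsum_le_tsum hle)
  filter_upwards [ae_eventually_notMem hsum] with ω hω
  refine hω.mono fun k hk => ?_
  simp only [hS, Set.mem_setOf_eq, not_le] at hk
  have hk' : ((Finset.range k).filter fun i => ω ∈ F i).card ≤ ⌊ε * (k : ℝ)⌋₊ := by omega
  calc ((((Finset.range k).filter fun i => ω ∈ F i).card : ℕ) : ℝ) ≤ (⌊ε * (k : ℝ)⌋₊ : ℝ) := by exact_mod_cast hk'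
    _ ≤ ε * k := Nat.floor_le (by positivity)

/-- **Markov's inequality for a product of thresholds**: for measurable `X_i ≥ 0` with integrable product over a finite index set `I`
and levels `a_i > 0`: **`(∏_{i∈I} a_i) · ν(⋂_{i∈I} {a_i ≤ X_i}) ≤ ∫ ∏_{i∈I} X_i dν`**. [folklore] -/
theorem prod_mul_measureReal_biInter_le_integral_prod (ν : Measure Ω) [IsFiniteMeasure ν] {ι : Type*} (I : Finset ι)
    (X : ι → Ω → ℝ) (hX0 : ∀ i ∈ I, ∀ ω, 0 ≤ X i ω) (a : ι → ℝ) (ha : ∀ i ∈ I, 0 < a i)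
    (hmeas : ∀ i ∈ I, Measurable (X i)) (hint : Integrable (fun ω => ∏ i ∈ I, X i ω) ν) :
    (∏ i ∈ I, a i) * ν.real (⋂ i ∈ I, {ω | a i ≤ X i ω}) ≤ ∫ ω, ∏ i ∈ I, X i ω ∂ν := by
  classical
  set E := ⋂ i ∈ I, {ω | a i ≤ X i ω} with hE
  have hEm : MeasurableSet E :=
    Finset.measurableSet_biInter I fun i hi => measurableSet_le measurable_const (hmeas i hi)
  have hpt : ∀ ω, (∏ i ∈ I, a i) * E.indicator (1 : Ω → ℝ) ω ≤ ∏ i ∈ I, X i ω := by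
    intro ω
    by_cases hω : ω ∈ E
    · rw [Set.indicator_of_mem hω, Pi.one_apply, mul_one]
      exact Finset.prod_le_prod (fun i hi => (ha i hi).le) fun i hi => Set.mem_iInter₂.1 hω i hi
    · rw [Set.indicator_of_notMem hω, mul_zero]
      exact Finset.prod_nonneg fun i hi => hX0 i hi ω
  have hL : ∫ ω, (∏ i ∈ I, a i) * E.indicator (1 : Ω → ℝ) ω ∂ν = (∏ i ∈ I, a i) * ν.real E := by
    rw [integral_const_mul, integral_indicator_one hEm]
  have h : ∫ ω, (∏ i ∈ I, a i) * E.indicator (1 : Ω → ℝ) ω ∂ν ≤ ∫ ω, ∏ i ∈ I, X i ω ∂ν :=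
    integral_mono (((integrable_const (1 : ℝ)).indicator hEm).const_mul (∏ i ∈ I, a i)) hint hpt
  rwa [hL] at h

end Counting

/-! ## §2 The density of fat shells of the IIC -/

open Classical in
/-- Measurability and boundedness of a shell volume `V_S(ω) = #{x ∈ S : 0 ↔ x}` as a real function. [folklore] -/
theorem measurable_card_filter_openConn_finset (S : Finset (Site d)) :
    Measurable fun ω : BondConfig (Site d) =>
      ((((S.filter fun x => ω ∈ (openConn (0 : Site d) x : Set (BondConfig (Site d)))).card : ℕ) : ℝ)) := by
  have h : (fun ω : BondConfig (Site d) =>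
      ((((S.filter fun x => ω ∈ (openConn (0 : Site d) x : Set (BondConfig (Site d)))).card : ℕ) : ℝ))) =
      fun ω => ∑ x ∈ S, if ω ∈ (openConn (0 : Site d) x : Set (BondConfig (Site d))) then (1 : ℝ) else 0 := by
    funext ω
    rw [Finset.card_filter]
    push_cast
    rfl
  rw [h]
  exact Finset.measurable_sum S fun x _ => Measurable.ite (measurableSet_openConn_holds 0 x) measurable_const measurable_const

open Classical in
/-- **AT ALL BUT A FRACTION `ε` OF THE SCALES THE SHELL VOLUME OF KESTEN'S IIC IS AT MOST `(2K/ε)` TIMES ITS MEAN** (`p_c(ℤ^d)`, `d ≥ 2`;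
(A2)□ at aspect `(s,L)`, `2 ≤ s ≤ L`, `ϰ > 0`; `CU⁺_l(c_U)`, `l ≥ 2`, `c_U > 0`; UAD).  There are `ρ', R₀ ≥ 1` and `K > 0` such that for
every IIC probability measure `ν`, every `ε > 0` and every `M` with `2K ≤ εM`, along the scales `R_i = R₀ ρ'^i` and with
`V_i = #{x ∈ Λ(2R_i) ∖ Λ(R_i) : 0 ↔ x}`: **`ν`-almost surely, for all large `k`, `#{i < k : V_i ≥ M · E_ν V_i} ≤ ε·k`** — the set of
`M`-fat scales has upper density at most `2K/M`.  (Markov on gen 19 (14)'s mixed moments gives `ν(⋂_{i∈I}{V_i ≥ M E V_i}) ≤ A(K/M)^{#I}`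
for every finite `I`; then the counting lemma.)  The almost-sure content of the mixed-moment factorisation; an SLLN is not claimed.
[cite: Kesten1986, Thm. (8)] [cite: BasuSapozhnikov2017ECP, Thm. 1.1] -/
theorem exists_iicMeasure_ae_density_fatShells_le_criticalProbI (hd : 2 ≤ d) {s L : ℕ} (hs : 2 ≤ s) (hsL : s ≤ L)
    {ϰ : ℝ} (hϰ : 0 < ϰ) (hA2 : SetToSetQuasiMultAspectAt d (criticalProbI d) s L ϰ) {l : ℕ} (hl : 2 ≤ l) {cU : ℝ} (hcU : 0 < cU)
    (hCU : ∀ a : ℕ, 1 ≤ a → ∀ E : Set (BondConfig (Site d)), IsUpperSet E → MeasurableSet E →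
      cU * (bondPercolation (zdGraph d) (criticalProbI d)).real E ≤ (bondPercolation (zdGraph d) (criticalProbI d)).real (E ∩
        {ω : BondConfig (Site d) | ∀ t ∈ innerBoundary (zdGraph d) (box d a), ∀ s ∈ innerBoundary (zdGraph d) (box d (l * a)),
          ∀ t' ∈ innerBoundary (zdGraph d) (box d a), ∀ s' ∈ innerBoundary (zdGraph d) (box d (l * a)),
          ω ∈ openConnIn (↑((box d (l * a) \ box d a) ∪ innerBoundary (zdGraph d) (box d a)) : Set (Site d)) t s →
          ω ∈ openConnIn (↑((box d (l * a) \ box d a) ∪ innerBoundary (zdGraph d) (box d a)) : Set (Site d)) t' s' →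
          ω ∈ openConnIn (↑((box d (l * a) \ box d a) ∪ innerBoundary (zdGraph d) (box d a)) : Set (Site d)) s s'}))
    (hUAD : ∀ ε : ℝ, 0 < ε → ∃ K₀ : ℕ, ∀ m : ℕ, 1 ≤ m → ∀ N : ℕ, K₀ * m ≤ N →
      (bondPercolation (zdGraph d) (criticalProbI d)).real (boxCrossing d m N) ≤ ε) :
    ∃ (ρ' R₀ : ℕ) (K : ℝ), 1 ≤ ρ' ∧ 1 ≤ R₀ ∧ 0 < K ∧ ∀ (ν : Measure (BondConfig (Site d))) [IsProbabilityMeasure ν],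
      (∀ (F : Finset (Sym2 (Site d))) (E : Set (BondConfig (Site d))), MeasurableSet E → DeterminedBy E ↑F →
        Tendsto (fun n : ℕ => (bondPercolation (zdGraph d) (criticalProbI d)).real (E ∩ siteToBoundary d n) /
          oneArmProb d (criticalProbI d) n) atTop (𝓝 (ν.real E))) →
      ∀ (ε M : ℝ), 0 < ε → 2 * K ≤ ε * M →
        ∀ᵐ ω ∂ν, ∀ᶠ k : ℕ in atTop,
          ((((Finset.range k).filter fun i =>
              M * ∫ ω', ((((box d (2 * (R₀ * ρ' ^ i)) \ box d (R₀ * ρ' ^ i)).filter fun x =>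
                ω' ∈ (openConn (0 : Site d) x : Set (BondConfig (Site d)))).card : ℕ) : ℝ) ∂ν ≤
              ((((box d (2 * (R₀ * ρ' ^ i)) \ box d (R₀ * ρ' ^ i)).filter fun x =>
                ω ∈ (openConn (0 : Site d) x : Set (BondConfig (Site d)))).card : ℕ) : ℝ)).card : ℕ) : ℝ) ≤ ε * k := by
  have hd1 : 1 ≤ d := le_trans (by norm_num) hd
  have hp : 0 < ((criticalProbI d : unitInterval) : ℝ) := by
    rw [coe_criticalProbI]; exact criticalProb_zd_pos d hd1
  obtain ⟨ρ', R₀, A, K, hρ', hR₀, hA, hK, hmix⟩ := exists_integral_prod_shellVolume_le_criticalProbI hd hs hsL hϰ hA2 hl hcU hCU hUAD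
  refine ⟨ρ', R₀, K, hρ', hR₀, hK, fun ν _ hν ε M hε hKM => ?_⟩
  have hM : 0 < M := by
    by_contra h
    have hεM : ε * M ≤ 0 := mul_nonpos_iff.2 (Or.inl ⟨hε.le, not_lt.1 h⟩)
    linarith
  -- notation
  set Rad : ℕ → ℕ := fun i => R₀ * ρ' ^ i with hRad
  set V : ℕ → BondConfig (Site d) → ℝ := fun i ω => ((((box d (2 * Rad i) \ box d (Rad i)).filter fun x =>
    ω ∈ (openConn (0 : Site d) x : Set (BondConfig (Site d)))).card : ℕ) : ℝ) with hV
  set m : ℕ → ℝ := fun i => ∫ ω', V i ω' ∂ν with hm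
  set F : ℕ → Set (BondConfig (Site d)) := fun i => {ω | M * m i ≤ V i ω} with hF
  have hVmeas : ∀ i, Measurable (V i) := fun i => measurable_card_filter_openConn_finset _
  have hV0 : ∀ i ω, 0 ≤ V i ω := fun i ω => Nat.cast_nonneg _
  have hVbd : ∀ i ω, V i ω ≤ ((box d (2 * Rad i) \ box d (Rad i)).card : ℝ) := fun i ω => by
    simp only [hV]; exact_mod_cast Finset.card_filter_le _ _
  have hFm : ∀ i, MeasurableSet (F i) := fun i => measurableSet_le measurable_const (hVmeas i)
  -- the means are positive (the IIC two-point function is positive)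
  have hRad1 : ∀ i, 1 ≤ Rad i := fun i => by
    simp only [hRad]; exact le_trans hR₀ (Nat.le_mul_of_pos_right _ (pow_pos (by omega) i))
  have hm0 : ∀ i, 0 < m i := by
    intro i
    -- a site on the sphere of radius `2 Rad i`
    set x₀ : Site d := Pi.single ⟨0, by omega⟩ ((2 * Rad i : ℕ) : ℤ) with hx₀
    have hx₀S : x₀ ∈ box d (2 * Rad i) \ box d (Rad i) := by
      have hn : Site.supNorm x₀ = 2 * Rad i := by rw [hx₀, supNorm_single_natCast]
      rw [Finset.mem_sdiff, mem_box_iff_supNorm_le, mem_box_iff_supNorm_le, hn]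
      have := hRad1 i; omega
    have hpos : 0 < ν.real (openConn (0 : Site d) x₀) := iicMeasure_real_openConn_pos hd1 _ hp hν x₀
    have hsum : m i = ∑ x ∈ box d (2 * Rad i) \ box d (Rad i), ν.real (openConn (0 : Site d) x) := by
      simp only [hm, hV]
      exact integral_card_filter_eq_sum ν _ _ fun x _ => measurableSet_openConn_holds 0 x
    rw [hsum]
    exact lt_of_lt_of_le hpos (Finset.single_le_sum (fun x _ => measureReal_nonneg) hx₀S)
  -- the product bound on finite intersections
  have hprod : ∀ I : Finset ℕ, ν.real (⋂ i ∈ I, F i) ≤ max A 1 * (K / M) ^ I.card := by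
    intro I
    rcases I.eq_empty_or_nonempty with hI | hI
    · rw [hI]
      simp only [Finset.notMem_empty, Set.iInter_of_empty, Set.iInter_univ, Finset.card_empty, pow_zero, mul_one]
      exact measureReal_le_one.trans (le_max_right _ _)
    -- enumerate `I` increasingly
    set k := I.card with hk
    have hk1 : 1 ≤ k := Finset.card_pos.2 hI
    set e : Fin k ↪o ℕ := I.orderEmbOfFin hk.symm with he
    have heI : ∀ j, e j ∈ I := fun j => I.orderEmbOfFin_mem hk.symm j
    set R : Fin k → ℕ := fun j => Rad (e j) with hR
    have hRR₀ : ∀ j, R₀ ≤ R j := fun j => by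
      simp only [hR, hRad]; exact Nat.le_mul_of_pos_right _ (pow_pos (by omega) _)
    have hRsep : ∀ i j : Fin k, i.val + 1 = j.val → ρ' * R i ≤ R j := by
      intro i j hij
      have hlt : e i < e j := e.strictMono (Fin.lt_def.2 (by omega))
      simp only [hR, hRad]
      calc ρ' * (R₀ * ρ' ^ (e i : ℕ)) = R₀ * ρ' ^ ((e i : ℕ) + 1) := by ring
        _ ≤ R₀ * ρ' ^ (e j : ℕ) := Nat.mul_le_mul_left _ (Nat.pow_le_pow_right (by omega) (by omega))
    have hmixI := hmix ν hν k hk1 R hRR₀ hRsep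
    -- reindex the intersection and the products along `e`
    have hinter : (⋂ i ∈ I, F i) = ⋂ j : Fin k, {ω | M * m (e j) ≤ V (e j) ω} := by
      ext ω
      simp only [Set.mem_iInter, Set.mem_setOf_eq, hF]
      constructor
      · exact fun h j => h (e j) (heI j)
      · intro h i hi
        obtain ⟨j, hj⟩ : ∃ j : Fin k, e j = i := by
          have : i ∈ Set.range e := by rw [he, Finset.range_orderEmbOfFin]; exact hi
          exact this
        rw [← hj]; exact h j
    have hint : Integrable (fun ω => ∏ j : Fin k, V (e j) ω) ν := by
      refine Integrable.of_bound (Finset.univ.measurable_prod (f := fun j ω => V (e j) ω)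
        fun j _ => hVmeas (e j)).aestronglyMeasurable (∏ j : Fin k, ((box d (2 * R j) \ box d (R j)).card : ℝ))
        (Eventually.of_forall fun ω => ?_)
      rw [Real.norm_eq_abs, abs_of_nonneg (Finset.prod_nonneg fun j _ => hV0 _ ω)]
      exact Finset.prod_le_prod (fun j _ => hV0 _ ω) fun j _ => hVbd (e j) ω
    have hMarkov := prod_mul_measureReal_biInter_le_integral_prod ν Finset.univ (fun j : Fin k => V (e j))
      (fun j _ ω => hV0 _ ω) (fun j => M * m (e j)) (fun j _ => mul_pos hM (hm0 _)) (fun j _ => hVmeas _) hint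
    have huniv : (⋂ j ∈ (Finset.univ : Finset (Fin k)), {ω | M * m (e j) ≤ V (e j) ω}) =
        ⋂ j : Fin k, {ω | M * m (e j) ≤ V (e j) ω} := by
      ext ω; simp
    rw [huniv, ← hinter] at hMarkov
    -- `∫ ∏ V ≤ A K^k ∏ m`
    have hup : ∫ ω, ∏ j : Fin k, V (e j) ω ∂ν ≤ A * K ^ k * ∏ j : Fin k, m (e j) := hmixI
    have hprodm : 0 < ∏ j : Fin k, (M * m (e j)) := Finset.prod_pos fun j _ => mul_pos hM (hm0 _)
    have hMm : ∏ j : Fin k, (M * m (e j)) = M ^ k * ∏ j : Fin k, m (e j) := by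
      rw [Finset.prod_mul_distrib, Finset.prod_const, Finset.card_univ, Fintype.card_fin]
    calc ν.real (⋂ i ∈ I, F i) ≤ (∫ ω, ∏ j : Fin k, V (e j) ω ∂ν) / ∏ j : Fin k, (M * m (e j)) := by
          rw [le_div_iff₀ hprodm, mul_comm]; exact hMarkov
      _ ≤ (A * K ^ k * ∏ j : Fin k, m (e j)) / ∏ j : Fin k, (M * m (e j)) := div_le_div_of_nonneg_right hup hprodm.le
      _ = A * (K / M) ^ k := by
          rw [hMm, div_pow]
          have hm' : (∏ j : Fin k, m (e j)) ≠ 0 := (Finset.prod_pos fun j _ => hm0 (e j)).ne'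
          have hMk : M ^ k ≠ 0 := pow_ne_zero k hM.ne'
          field_simp
      _ ≤ max A 1 * (K / M) ^ k := mul_le_mul_of_nonneg_right (le_max_left _ _) (pow_nonneg (div_nonneg hK.le hM.le) k)
  -- the counting lemma, almost surely
  have hq : 2 * (K / M) ≤ ε := by
    rw [mul_div_assoc', div_le_iff₀ hM]; linarith
  have h := ae_eventually_card_filter_le_mul ν F hFm (le_trans zero_le_one (le_max_right A 1)) (div_nonneg hK.le hM.le) hε hq hprod
  filter_upwards [h] with ω hω
  refine hω.mono fun k hk => ?_
  simpa only [hF, hm, hV, hRad, Set.mem_setOf_eq] using hk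

open Classical in
/-- Complementary count for the density lemmas: if `ν`-a.s. eventually `#{i<k : F_i} ≤ εk`, then `ν`-a.s. eventually
`(1−ε)k ≤ #{i<k : ¬F_i}` — the GOOD indices have lower density at least `1 − ε`. [folklore] -/
theorem ae_eventually_le_card_filter_not {Ω : Type*} [MeasurableSpace Ω] (ν : Measure Ω) (F : ℕ → Set Ω) {ε : ℝ}
    (h : ∀ᵐ ω ∂ν, ∀ᶠ k : ℕ in atTop, ((((Finset.range k).filter fun i => ω ∈ F i).card : ℕ) : ℝ) ≤ ε * k) :
    ∀ᵐ ω ∂ν, ∀ᶠ k : ℕ in atTop, (1 - ε) * k ≤ ((((Finset.range k).filter fun i => ω ∉ F i).card : ℕ) : ℝ) := by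
  filter_upwards [h] with ω hω
  refine hω.mono fun k hk => ?_
  have hsum := Finset.card_filter_add_card_filter_not (s := Finset.range k) (fun i => ω ∈ F i)
  rw [Finset.card_range] at hsum
  have hsum' : ((((Finset.range k).filter fun i => ω ∈ F i).card : ℕ) : ℝ) +
      ((((Finset.range k).filter fun i => ω ∉ F i).card : ℕ) : ℝ) = k := by exact_mod_cast hsum
  linarith

end Summit.CriticalPhenomena.PercolationContinuityZ3.Theorems.Crossing

end
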